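import Summits.AnomalousDissipation.AnomalousDissipation.Theorems.MomentParityQuarticGateDesignBudget
import Summits.AnomalousDissipation.AnomalousDissipation.Theorems.MomentParityQuarticGateAtomRows

/-!
# The explicit order-2 design: the rows summed over the atoms

Helper file for stub S6 (`stub_order2Design`) of the line `recession-cone` of crux
`MomentParity.QuarticGate`, continuing `MomentParityQuarticGateDesignSums` / `…DesignBudget` (same
coefficient families `cf, cA, cB, cC, cR`, passed as variables with defining hypotheses) and using
the per-atom row formulas of `MomentParityQuarticGateAtomRows`. For a family of energy-space
elements `U p` represented by the design atoms `realTrigPoly S ĉ(p)` this file sums, over the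
atoms `p`, the LINEAR ROWS (`∑_p ⟨F(U p), g⟩ = #ι (1 - 4π²ν - πA₁B₂) (f, g)`), the ENERGY ROW,
the HELICITY ROW (`= 0`), the energies and the enstrophies, and records the covariance increment
between two atoms differing only in the sign of the noise.
-/

namespace Summit.AnomalousDissipation.AnomalousDissipation.Theorems.MomentParityQuarticGate

open MeasureTheory Filter Complex
open scoped InnerProductSpace RealInnerProductSpace ComplexConjugate ENNReal
open Literature.Analysis.FunctionSpaces Literature.Analysis.FluidPDE

set_option linter.dupNamespace false

section RowSums

variable {N : ℕ} {A₁ B₂ c η : ℝ}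
  {cf cC : (Fin 3 → ℤ) → EuclideanSpace ℂ (Fin 3)} {cA cB : Fin 4 → (Fin 3 → ℤ) → EuclideanSpace ℂ (Fin 3)}
  {cR : Torus.FrameIdx (Fin 3) N → (Fin 3 → ℤ) → EuclideanSpace ℂ (Fin 3)}
  (hcf : cf = (Pi.single (![0, 1, 0] : Fin 3 → ℤ) (((1 / 2 : ℂ)) • EuclideanSpace.complexify (WithLp.toLp 2 ![(1 : ℝ), 0, 0] : EuclideanSpace ℝ (Fin 3))) +
        Pi.single (-(![0, 1, 0] : Fin 3 → ℤ)) ((starRingEnd ℂ) ((1 / 2 : ℂ)) • EuclideanSpace.complexify (WithLp.toLp 2 ![(1 : ℝ), 0, 0] : EuclideanSpace ℝ (Fin 3))) : (Fin 3 → ℤ) → EuclideanSpace ℂ (Fin 3)))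
  (hcA : cA = fun m : Fin 4 => (Pi.single (![0, 0, 1] : Fin 3 → ℤ) ((((A₁ / 2 : ℝ) : ℂ) * Complex.I ^ (m : ℕ)) • EuclideanSpace.complexify (WithLp.toLp 2 ![(1 : ℝ), 0, 0] : EuclideanSpace ℝ (Fin 3))) +
        Pi.single (-(![0, 0, 1] : Fin 3 → ℤ)) ((starRingEnd ℂ) (((A₁ / 2 : ℝ) : ℂ) * Complex.I ^ (m : ℕ)) • EuclideanSpace.complexify (WithLp.toLp 2 ![(1 : ℝ), 0, 0] : EuclideanSpace ℝ (Fin 3))) : (Fin 3 → ℤ) → EuclideanSpace ℂ (Fin 3)))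
  (hcB : cB = fun m : Fin 4 => (Pi.single (![0, 1, 1] : Fin 3 → ℤ) ((((B₂ / 2 : ℝ) : ℂ) * -Complex.I * Complex.I ^ (m : ℕ)) • EuclideanSpace.complexify (WithLp.toLp 2 ![(0 : ℝ), 1, -1] : EuclideanSpace ℝ (Fin 3))) +
        Pi.single (-(![0, 1, 1] : Fin 3 → ℤ)) ((starRingEnd ℂ) (((B₂ / 2 : ℝ) : ℂ) * -Complex.I * Complex.I ^ (m : ℕ)) • EuclideanSpace.complexify (WithLp.toLp 2 ![(0 : ℝ), 1, -1] : EuclideanSpace ℝ (Fin 3))) : (Fin 3 → ℤ) → EuclideanSpace ℂ (Fin 3)))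
  (hcC : cC = (Pi.single (![0, 0, (N : ℤ)] : Fin 3 → ℤ) ((((c / 2 : ℝ) : ℂ)) • EuclideanSpace.complexify (WithLp.toLp 2 ![(1 : ℝ), 0, 0] : EuclideanSpace ℝ (Fin 3))) +
        Pi.single (-(![0, 0, (N : ℤ)] : Fin 3 → ℤ)) ((starRingEnd ℂ) (((c / 2 : ℝ) : ℂ)) • EuclideanSpace.complexify (WithLp.toLp 2 ![(1 : ℝ), 0, 0] : EuclideanSpace ℝ (Fin 3))) : (Fin 3 → ℤ) → EuclideanSpace ℂ (Fin 3)))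
  (hcR : cR = fun a : Torus.FrameIdx (Fin 3) N => (Pi.single (a.1 : Fin 3 → ℤ) ((((η / 2 : ℝ) : ℂ) * (if a.2.2 then (1 : ℂ) else -Complex.I)) • EuclideanSpace.complexify (Torus.perpVec (a.1 : Fin 3 → ℤ) a.2.1)) +
        Pi.single (-(a.1 : Fin 3 → ℤ)) ((starRingEnd ℂ) (((η / 2 : ℝ) : ℂ) * (if a.2.2 then (1 : ℂ) else -Complex.I)) • EuclideanSpace.complexify (Torus.perpVec (a.1 : Fin 3 → ℤ) a.2.1)) : (Fin 3 → ℤ) → EuclideanSpace ℂ (Fin 3)))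
  {U : (Fin 4 × Torus.FrameIdx (Fin 3) N × Bool × Bool) → Torus.energySpace (Fin 3)}
  (hU : ∀ p : (Fin 4 × Torus.FrameIdx (Fin 3) N × Bool × Bool), (((U p).1 : Lp (EuclideanSpace ℝ (Fin 3)) 2 (volume : Measure (UnitAddTorus (Fin 3)))) : UnitAddTorus (Fin 3) → EuclideanSpace ℝ (Fin 3)) =ᵐ[volume]
    Torus.realTrigPoly ((Torus.freqBall N).erase 0) (cf + cA p.1 + cB p.1 + (if p.2.2.1 then (1 : ℝ) else -1) • cC + (if p.2.2.2 then (1 : ℝ) else -1) • cR p.2.1))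

/-! ## The force mode -/

include hcf in
/-- **The force is the real mode of `cf`**: `realTrigPoly S cf = cos(2πx₁) e₀` at every level
`N ≥ 2`. [folklore] -/
theorem design_force_eq (hN : 2 ≤ N) :
    Torus.realTrigPoly ((Torus.freqBall N).erase 0) cf = (Torus.realTrigPoly {(![0, 1, 0] : Fin 3 → ℤ)} (fun _ => (1 : ℂ) • EuclideanSpace.complexify (WithLp.toLp 2 ![(1 : ℝ), 0, 0] : EuclideanSpace ℝ (Fin 3)))) := by
  obtain ⟨hkF, hnkF, -⟩ := design_mem hN
  obtain ⟨hF0, -⟩ := design_freq_facts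
  rw [hcf, ← realTrigPoly_single_add_single hkF hnkF hF0 (1 : ℂ)]

include hcf in
/-- The force mode family is conjugate symmetric. [folklore] -/
theorem design_isConjSymm_cf : Torus.IsConjSymm cf := by
  rw [hcf]; exact isConjSymm_single_add_single _ _ _

include hcf in
/-- **Fourier coefficients of the force**: `cf` on `S`, `0` outside. [folklore] -/
theorem design_mFourierCoeff_force (hN : 2 ≤ N) (k : Fin 3 → ℤ) :
    UnitAddTorus.mFourierCoeff (EuclideanSpace.complexify ∘ (Torus.realTrigPoly {(![0, 1, 0] : Fin 3 → ℤ)} (fun _ => (1 : ℂ) • EuclideanSpace.complexify (WithLp.toLp 2 ![(1 : ℝ), 0, 0] : EuclideanSpace ℝ (Fin 3))))) k =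
      if k ∈ ((Torus.freqBall N).erase 0) then cf k else 0 := by
  rw [← design_force_eq hcf hN, Torus.mFourierCoeff_realTrigPoly neg_mem_freqBall_erase_zero (design_isConjSymm_cf hcf)]

include hcf in
/-- **Pairings with the force in Fourier variables**: `∑_{k∈S} Re ⟪cf k, ĝ k⟫ = ∫ ⟪f, g⟫`.
[folklore] -/
theorem design_sum_re_inner_cf (hN : 2 ≤ N) {g : UnitAddTorus (Fin 3) → EuclideanSpace ℝ (Fin 3)}
    (hg : Integrable g volume) :
    ∑ k ∈ ((Torus.freqBall N).erase 0), (inner ℂ (cf k) (UnitAddTorus.mFourierCoeff (EuclideanSpace.complexify ∘ g) k)).re =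
      ∫ x, ⟪(Torus.realTrigPoly {(![0, 1, 0] : Fin 3 → ℤ)} (fun _ => (1 : ℂ) • EuclideanSpace.complexify (WithLp.toLp 2 ![(1 : ℝ), 0, 0] : EuclideanSpace ℝ (Fin 3)))) x, g x⟫_ℝ := by
  rw [← design_force_eq hcf hN, Torus.integral_inner_realTrigPoly_of_integrable_left _ _ hg]

include hcf in
/-- **The Stokes symbol of the force**: `∑_{k∈S} Re ⟪-4π²|k|² cf k, ĝ k⟫ = -4π² ∫ ⟪f, g⟫`
(`Δf = -4π² f`, `|kF|² = 1`). [folklore] -/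
theorem design_sum_re_inner_laplacian_cf (hN : 2 ≤ N) {g : UnitAddTorus (Fin 3) → EuclideanSpace ℝ (Fin 3)}
    (hg : Integrable g volume) :
    ∑ k ∈ ((Torus.freqBall N).erase 0), (inner ℂ (-(((4 * Real.pi ^ 2 * Torus.freqNormSq k : ℝ) : ℂ) • cf k))
      (UnitAddTorus.mFourierCoeff (EuclideanSpace.complexify ∘ g) k)).re =
      -(4 * Real.pi ^ 2) * ∫ x, ⟪(Torus.realTrigPoly {(![0, 1, 0] : Fin 3 → ℤ)} (fun _ => (1 : ℂ) • EuclideanSpace.complexify (WithLp.toLp 2 ![(1 : ℝ), 0, 0] : EuclideanSpace ℝ (Fin 3)))) x, g x⟫_ℝ := by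
  obtain ⟨nF, -⟩ := design_freqNormSq N
  rw [← Torus.integral_inner_realTrigPoly_of_integrable_left _ _ hg, ← integral_const_mul]
  refine integral_congr_ae (ae_of_all _ fun x => ?_)
  show ⟪Torus.realTrigPoly _ _ x, g x⟫_ℝ = -(4 * Real.pi ^ 2) * ⟪_, g x⟫_ℝ
  rw [← Torus.laplacian_realTrigPoly, design_force_eq hcf hN, Torus.laplacian_realTrigPoly_singleton, nF, mul_one,
    real_inner_smul_left]

/-! ## Pushing the sum over the atoms inside the Fourier pairings -/

/-- Sums of real parts of pairings with a scaled family are pairings with the scaled sum. [folklore] -/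
theorem sum_re_inner_smul_apply {ι : Type*} (s : Finset ι) (x : ι → (Fin 3 → ℤ) → EuclideanSpace ℂ (Fin 3)) (a : ℂ)
    (y : EuclideanSpace ℂ (Fin 3)) (k : Fin 3 → ℤ) :
    ∑ p ∈ s, (inner ℂ (a • x p k) y).re = (inner ℂ (a • (∑ p ∈ s, x p) k) y).re := by
  rw [Finset.sum_apply, Finset.smul_sum, sum_inner, Complex.re_sum]

/-- The curl symbol is additive over finite sums. [folklore] -/
theorem curlCoeff_sum {ι : Type*} (s : Finset ι) (x : ι → (Fin 3 → ℤ) → EuclideanSpace ℂ (Fin 3)) (k : Fin 3 → ℤ) :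
    IntermittentBeltrami.curlCoeff (∑ p ∈ s, x p) k = ∑ p ∈ s, IntermittentBeltrami.curlCoeff (x p) k := by
  classical
  induction s using Finset.induction_on with
  | empty => simp [curlCoeff_apply_eq_zero]
  | insert i s hi ih => rw [Finset.sum_insert hi, Finset.sum_insert hi, curlCoeff_add, ih]


/-! ## The linear rows summed over the atoms -/

include hcf hcA hcB hcC hcR hU in
/-- **THE LINEAR ROWS of the design, summed over the atoms**: for every smooth band test `g`,
`∑_p ⟨F(U p), g⟩ = #ι · (1 - 4π²ν - πA₁B₂) · ∫⟪f, g⟫` — the mean flow is the force mode, its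
Stokes term is `-4π²ν (f, g)`, and the averaged Reynolds stress is `πA₁B₂ (f, g)`. [folklore] -/
theorem design_sum_linearRow (hN : 2 ≤ N) (ν : ℝ)
    {g : UnitAddTorus (Fin 3) → EuclideanSpace ℝ (Fin 3)} (hg : Torus.IsSmooth g)
    (hband : ∀ k ∉ (Torus.freqBall N).erase (0 : Fin 3 → ℤ),
      UnitAddTorus.mFourierCoeff (EuclideanSpace.complexify ∘ g) k = 0) :
    ∑ p : (Fin 4 × Torus.FrameIdx (Fin 3) N × Bool × Bool), Torus.nsGeneratorPairing ν (Torus.realTrigPoly {(![0, 1, 0] : Fin 3 → ℤ)} (fun _ => (1 : ℂ) • EuclideanSpace.complexify (WithLp.toLp 2 ![(1 : ℝ), 0, 0] : EuclideanSpace ℝ (Fin 3)))) (U p) g =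
      ((Fintype.card (Fin 4 × Torus.FrameIdx (Fin 3) N × Bool × Bool) : ℕ) : ℝ) * (1 - 4 * Real.pi ^ 2 * ν - Real.pi * A₁ * B₂) *
        ∫ x, ⟪(Torus.realTrigPoly {(![0, 1, 0] : Fin 3 → ℤ)} (fun _ => (1 : ℂ) • EuclideanSpace.complexify (WithLp.toLp 2 ![(1 : ℝ), 0, 0] : EuclideanSpace ℝ (Fin 3)))) x, g x⟫_ℝ := by
  have hrow : ∀ p : (Fin 4 × Torus.FrameIdx (Fin 3) N × Bool × Bool), Torus.nsGeneratorPairing ν (Torus.realTrigPoly {(![0, 1, 0] : Fin 3 → ℤ)} (fun _ => (1 : ℂ) • EuclideanSpace.complexify (WithLp.toLp 2 ![(1 : ℝ), 0, 0] : EuclideanSpace ℝ (Fin 3)))) (U p) g = _ :=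
    fun p => nsGeneratorPairing_of_ae_eq (hU p) (design_isConjSymm hcf hcA hcB hcC hcR p)
      (design_isTransversal hcf hcA hcB hcC hcR p) ν _ hg hband
  simp_rw [hrow]
  rw [Finset.sum_sub_distrib, Finset.sum_add_distrib, Finset.sum_const, Finset.card_univ, nsmul_eq_mul,
    ← Finset.mul_sum, Finset.sum_comm, Finset.sum_comm (f := fun p k => (inner ℂ
      (Torus.convectionCoeff ((Torus.freqBall N).erase 0) _ _ k) (UnitAddTorus.mFourierCoeff (EuclideanSpace.complexify ∘ g) k)).re)]
  have h1 : ∀ k : Fin 3 → ℤ, ∑ p : (Fin 4 × Torus.FrameIdx (Fin 3) N × Bool × Bool),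
      (inner ℂ (-(((4 * Real.pi ^ 2 * Torus.freqNormSq k : ℝ) : ℂ) • (cf + cA p.1 + cB p.1 + (if p.2.2.1 then (1 : ℝ) else -1) • cC + (if p.2.2.2 then (1 : ℝ) else -1) • cR p.2.1) k))
        (UnitAddTorus.mFourierCoeff (EuclideanSpace.complexify ∘ g) k)).re =
      ((Fintype.card (Fin 4 × Torus.FrameIdx (Fin 3) N × Bool × Bool) : ℕ) : ℝ) *
        (inner ℂ (-(((4 * Real.pi ^ 2 * Torus.freqNormSq k : ℝ) : ℂ) • cf k))
          (UnitAddTorus.mFourierCoeff (EuclideanSpace.complexify ∘ g) k)).re := by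
    intro k
    simp_rw [← neg_smul]
    rw [sum_re_inner_smul_apply Finset.univ (fun p : (Fin 4 × Torus.FrameIdx (Fin 3) N × Bool × Bool) => (cf + cA p.1 + cB p.1 + (if p.2.2.1 then (1 : ℝ) else -1) • cC + (if p.2.2.2 then (1 : ℝ) else -1) • cR p.2.1)), design_sum_atoms hcA hcB,
      Pi.smul_apply, ← Complex.coe_smul, smul_comm, inner_smul_left, Complex.conj_ofReal, Complex.re_ofReal_mul]
  have h2 : ∀ k : Fin 3 → ℤ, ∑ p : (Fin 4 × Torus.FrameIdx (Fin 3) N × Bool × Bool),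
      (inner ℂ (Torus.convectionCoeff ((Torus.freqBall N).erase 0) (cf + cA p.1 + cB p.1 + (if p.2.2.1 then (1 : ℝ) else -1) • cC + (if p.2.2.2 then (1 : ℝ) else -1) • cR p.2.1) (cf + cA p.1 + cB p.1 + (if p.2.2.1 then (1 : ℝ) else -1) • cC + (if p.2.2.2 then (1 : ℝ) else -1) • cR p.2.1) k)
        (UnitAddTorus.mFourierCoeff (EuclideanSpace.complexify ∘ g) k)).re =
      (((Fintype.card (Fin 4 × Torus.FrameIdx (Fin 3) N × Bool × Bool) : ℕ) : ℝ) * (Real.pi * A₁ * B₂)) *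
        (inner ℂ (cf k) (UnitAddTorus.mFourierCoeff (EuclideanSpace.complexify ∘ g) k)).re := by
    intro k
    rw [← Complex.re_sum, ← sum_inner, ← Finset.sum_apply, design_sum_convectionCoeff hcf hcA hcB hcC hcR hN,
      Pi.smul_apply, ← Complex.coe_smul, inner_smul_left, Complex.conj_ofReal, Complex.re_ofReal_mul]
  simp_rw [h1, h2]
  rw [← Finset.mul_sum, ← Finset.mul_sum, design_sum_re_inner_laplacian_cf hcf hN hg.integrable,
    design_sum_re_inner_cf hcf hN hg.integrable]
  ring


/-! ## The energy row summed over the atoms -/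

include hcf in
/-- The energy injected by the force into the mean flow: `∑_{k∈S} Re ⟪f̂ k, cf k⟫ = 1/2 = ‖f‖²`.
[folklore] -/
theorem design_injection (hN : 2 ≤ N) :
    ∑ k ∈ ((Torus.freqBall N).erase 0), (inner ℂ (UnitAddTorus.mFourierCoeff (EuclideanSpace.complexify ∘ (Torus.realTrigPoly {(![0, 1, 0] : Fin 3 → ℤ)} (fun _ => (1 : ℂ) • EuclideanSpace.complexify (WithLp.toLp 2 ![(1 : ℝ), 0, 0] : EuclideanSpace ℝ (Fin 3))))) k) (cf k)).re =
      1 / 2 := by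
  obtain ⟨hkF, hnkF, -⟩ := design_mem hN
  obtain ⟨hF0, -⟩ := design_freq_facts
  obtain ⟨ne, -, n1, -⟩ := design_norms 0 0 0 0 0 true
  have h : ∀ k ∈ ((Torus.freqBall N).erase 0), (inner ℂ (UnitAddTorus.mFourierCoeff (EuclideanSpace.complexify ∘ (Torus.realTrigPoly {(![0, 1, 0] : Fin 3 → ℤ)} (fun _ => (1 : ℂ) • EuclideanSpace.complexify (WithLp.toLp 2 ![(1 : ℝ), 0, 0] : EuclideanSpace ℝ (Fin 3))))) k)
      (cf k)).re = 1 * ‖cf k‖ ^ 2 := fun k hk => by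
    rw [design_mFourierCoeff_force hcf hN, if_pos hk, one_mul]
    have := inner_self_eq_norm_sq (𝕜 := ℂ) (cf k)
    rwa [RCLike.re_to_complex] at this
  rw [Finset.sum_congr rfl h]
  simp_rw [one_mul]
  rw [hcf, sum_norm_sq_polarised hkF hnkF hF0, ne, n1]
  norm_num

include hcf hcA hcB hcC hcR hU in
/-- **THE ENERGY ROW of the design, summed over the atoms**:
`∑_p ⟨F(U p), P_N U p⟩ = #ι/2 - 4π²ν · (#ι (1/2 + A₁²/2 + 2B₂² + N²c²/2) + 16 ∑_a G(cR a))`.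
[folklore] -/
theorem design_sum_energyRow (hN : 2 ≤ N) (ν : ℝ) :
    ∑ p : (Fin 4 × Torus.FrameIdx (Fin 3) N × Bool × Bool), Torus.nsGeneratorPairing ν (Torus.realTrigPoly {(![0, 1, 0] : Fin 3 → ℤ)} (fun _ => (1 : ℂ) • EuclideanSpace.complexify (WithLp.toLp 2 ![(1 : ℝ), 0, 0] : EuclideanSpace ℝ (Fin 3)))) (U p)
      (Torus.fourierTruncate N (((U p).1 : Lp (EuclideanSpace ℝ (Fin 3)) 2 (volume : Measure (UnitAddTorus (Fin 3)))) : UnitAddTorus (Fin 3) → EuclideanSpace ℝ (Fin 3))) =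
      ((Fintype.card (Fin 4 × Torus.FrameIdx (Fin 3) N × Bool × Bool) : ℕ) : ℝ) * (1 / 2) -
        ν * (4 * Real.pi ^ 2 * (((Fintype.card (Fin 4 × Torus.FrameIdx (Fin 3) N × Bool × Bool) : ℕ) : ℝ) *
          (1 / 2 + A₁ ^ 2 / 2 + 2 * B₂ ^ 2 + (N : ℝ) ^ 2 * c ^ 2 / 2) +
          16 * ∑ a : Torus.FrameIdx (Fin 3) N, ∑ k ∈ ((Torus.freqBall N).erase 0), Torus.freqNormSq k * ‖(cR a) k‖ ^ 2)) := by
  have hfi : Integrable (Torus.realTrigPoly {(![0, 1, 0] : Fin 3 → ℤ)} (fun _ => (1 : ℂ) • EuclideanSpace.complexify (WithLp.toLp 2 ![(1 : ℝ), 0, 0] : EuclideanSpace ℝ (Fin 3)))) volume := (Torus.isSmooth_realTrigPoly _ _).integrable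
  have hrow : ∀ p : (Fin 4 × Torus.FrameIdx (Fin 3) N × Bool × Bool), Torus.nsGeneratorPairing ν (Torus.realTrigPoly {(![0, 1, 0] : Fin 3 → ℤ)} (fun _ => (1 : ℂ) • EuclideanSpace.complexify (WithLp.toLp 2 ![(1 : ℝ), 0, 0] : EuclideanSpace ℝ (Fin 3)))) (U p)
      (Torus.fourierTruncate N (((U p).1 : Lp (EuclideanSpace ℝ (Fin 3)) 2 (volume : Measure (UnitAddTorus (Fin 3)))) : UnitAddTorus (Fin 3) → EuclideanSpace ℝ (Fin 3))) = _ :=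
    fun p => nsGeneratorPairing_fourierTruncate_of_ae_eq (hU p) (design_isConjSymm hcf hcA hcB hcC hcR p)
      (design_isTransversal hcf hcA hcB hcC hcR p) ν hfi
  simp_rw [hrow]
  rw [Finset.sum_sub_distrib, Finset.sum_comm, ← Finset.mul_sum, ← Finset.mul_sum,
    design_sum_enstrophy hcf hcA hcB hcC hN]
  have h1 : ∀ k : Fin 3 → ℤ, ∑ p : (Fin 4 × Torus.FrameIdx (Fin 3) N × Bool × Bool),
      (inner ℂ (UnitAddTorus.mFourierCoeff (EuclideanSpace.complexify ∘ (Torus.realTrigPoly {(![0, 1, 0] : Fin 3 → ℤ)} (fun _ => (1 : ℂ) • EuclideanSpace.complexify (WithLp.toLp 2 ![(1 : ℝ), 0, 0] : EuclideanSpace ℝ (Fin 3))))) k) ((cf + cA p.1 + cB p.1 + (if p.2.2.1 then (1 : ℝ) else -1) • cC + (if p.2.2.2 then (1 : ℝ) else -1) • cR p.2.1) k)).re =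
      ((Fintype.card (Fin 4 × Torus.FrameIdx (Fin 3) N × Bool × Bool) : ℕ) : ℝ) *
        (inner ℂ (UnitAddTorus.mFourierCoeff (EuclideanSpace.complexify ∘ (Torus.realTrigPoly {(![0, 1, 0] : Fin 3 → ℤ)} (fun _ => (1 : ℂ) • EuclideanSpace.complexify (WithLp.toLp 2 ![(1 : ℝ), 0, 0] : EuclideanSpace ℝ (Fin 3))))) k) (cf k)).re := by
    intro k
    rw [← Complex.re_sum, ← inner_sum, ← Finset.sum_apply, design_sum_atoms hcA hcB, Pi.smul_apply,
      ← Complex.coe_smul, inner_smul_right, Complex.re_ofReal_mul]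
  simp_rw [h1]
  rw [← Finset.mul_sum, design_injection hcf hN]

/-! ## The helicity row summed over the atoms -/

include hcf hcA hcB hcC hcR hU in
/-- **THE HELICITY ROW of the design, summed over the atoms, vanishes**: the force pairs with the
curl of the mean flow only (`(f, curl f) = 0`, linear polarisation) and the averaged helicity form
vanishes (`design_sum_curlForm`). [folklore] -/
theorem design_sum_helicityRow (hN : 2 ≤ N) (ν : ℝ) :
    ∑ p : (Fin 4 × Torus.FrameIdx (Fin 3) N × Bool × Bool), Torus.nsGeneratorPairing ν (Torus.realTrigPoly {(![0, 1, 0] : Fin 3 → ℤ)} (fun _ => (1 : ℂ) • EuclideanSpace.complexify (WithLp.toLp 2 ![(1 : ℝ), 0, 0] : EuclideanSpace ℝ (Fin 3)))) (U p)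
      (BDSV.curl (Torus.fourierTruncate N (((U p).1 : Lp (EuclideanSpace ℝ (Fin 3)) 2 (volume : Measure (UnitAddTorus (Fin 3)))) : UnitAddTorus (Fin 3) → EuclideanSpace ℝ (Fin 3)))) = 0 := by
  have hfi : Integrable (Torus.realTrigPoly {(![0, 1, 0] : Fin 3 → ℤ)} (fun _ => (1 : ℂ) • EuclideanSpace.complexify (WithLp.toLp 2 ![(1 : ℝ), 0, 0] : EuclideanSpace ℝ (Fin 3)))) volume := (Torus.isSmooth_realTrigPoly _ _).integrable
  have hrow : ∀ p : (Fin 4 × Torus.FrameIdx (Fin 3) N × Bool × Bool), Torus.nsGeneratorPairing ν (Torus.realTrigPoly {(![0, 1, 0] : Fin 3 → ℤ)} (fun _ => (1 : ℂ) • EuclideanSpace.complexify (WithLp.toLp 2 ![(1 : ℝ), 0, 0] : EuclideanSpace ℝ (Fin 3)))) (U p)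
      (BDSV.curl (Torus.fourierTruncate N (((U p).1 : Lp (EuclideanSpace ℝ (Fin 3)) 2 (volume : Measure (UnitAddTorus (Fin 3)))) : UnitAddTorus (Fin 3) → EuclideanSpace ℝ (Fin 3)))) = _ :=
    fun p => nsGeneratorPairing_curl_fourierTruncate_of_ae_eq (hU p) (design_isConjSymm hcf hcA hcB hcC hcR p)
      (design_isTransversal hcf hcA hcB hcC hcR p) ν hfi
  simp_rw [hrow]
  rw [Finset.sum_add_distrib, ← Finset.mul_sum]
  have h2 := design_sum_curlForm hcf hcA hcB hcC hcR (fun k => -(((4 * Real.pi ^ 2 * Torus.freqNormSq k : ℝ) : ℂ)))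
  simp only [neg_smul] at h2
  rw [h2, mul_zero, add_zero, Finset.sum_comm]
  have h1 : ∀ k : Fin 3 → ℤ, ∑ p : (Fin 4 × Torus.FrameIdx (Fin 3) N × Bool × Bool),
      (inner ℂ (UnitAddTorus.mFourierCoeff (EuclideanSpace.complexify ∘ (Torus.realTrigPoly {(![0, 1, 0] : Fin 3 → ℤ)} (fun _ => (1 : ℂ) • EuclideanSpace.complexify (WithLp.toLp 2 ![(1 : ℝ), 0, 0] : EuclideanSpace ℝ (Fin 3))))) k)
        (IntermittentBeltrami.curlCoeff (cf + cA p.1 + cB p.1 + (if p.2.2.1 then (1 : ℝ) else -1) • cC + (if p.2.2.2 then (1 : ℝ) else -1) • cR p.2.1) k)).re =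
      ((Fintype.card (Fin 4 × Torus.FrameIdx (Fin 3) N × Bool × Bool) : ℕ) : ℝ) *
        (inner ℂ (UnitAddTorus.mFourierCoeff (EuclideanSpace.complexify ∘ (Torus.realTrigPoly {(![0, 1, 0] : Fin 3 → ℤ)} (fun _ => (1 : ℂ) • EuclideanSpace.complexify (WithLp.toLp 2 ![(1 : ℝ), 0, 0] : EuclideanSpace ℝ (Fin 3))))) k)
          (IntermittentBeltrami.curlCoeff cf k)).re := by
    intro k
    rw [← Complex.re_sum, ← inner_sum, ← curlCoeff_sum, design_sum_atoms hcA hcB, curlCoeff_real_smul,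
      ← Complex.coe_smul, inner_smul_right, Complex.re_ofReal_mul]
  simp_rw [h1]
  rw [← Finset.mul_sum]
  have h3 : ∑ k ∈ ((Torus.freqBall N).erase 0), (inner ℂ (UnitAddTorus.mFourierCoeff (EuclideanSpace.complexify ∘ (Torus.realTrigPoly {(![0, 1, 0] : Fin 3 → ℤ)} (fun _ => (1 : ℂ) • EuclideanSpace.complexify (WithLp.toLp 2 ![(1 : ℝ), 0, 0] : EuclideanSpace ℝ (Fin 3))))) k)
      (IntermittentBeltrami.curlCoeff cf k)).re = 0 := by
    have h4 : ∀ k ∈ ((Torus.freqBall N).erase 0), (inner ℂ (UnitAddTorus.mFourierCoeff (EuclideanSpace.complexify ∘ (Torus.realTrigPoly {(![0, 1, 0] : Fin 3 → ℤ)} (fun _ => (1 : ℂ) • EuclideanSpace.complexify (WithLp.toLp 2 ![(1 : ℝ), 0, 0] : EuclideanSpace ℝ (Fin 3))))) k)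
        (IntermittentBeltrami.curlCoeff cf k)).re = (inner ℂ (cf k) ((1 : ℂ) • IntermittentBeltrami.curlCoeff cf k)).re :=
      fun k hk => by rw [design_mFourierCoeff_force hcf hN, if_pos hk, one_smul]
    rw [Finset.sum_congr rfl h4, hcf]
    exact sum_re_inner_smul_curlCoeff_polarised _ _ _ _ _ (fun _ => (1 : ℂ))
  rw [h3, mul_zero]


/-! ## Energies, enstrophies, levels, and the covariance increment -/

include hcf hcA hcB hcC hcR hU in
/-- **Total energy of the atoms**: `∑_p ‖U p‖² ≤ #ι (1/2 + A₁²/2 + B₂² + c²/2 + η²/2)`. [folklore] -/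
theorem design_sum_norm_sq_le (hN : 2 ≤ N) :
    ∑ p : (Fin 4 × Torus.FrameIdx (Fin 3) N × Bool × Bool), ‖U p‖ ^ 2 ≤
      ((Fintype.card (Fin 4 × Torus.FrameIdx (Fin 3) N × Bool × Bool) : ℕ) : ℝ) * (1 / 2 + A₁ ^ 2 / 2 + B₂ ^ 2 + c ^ 2 / 2 + η ^ 2 / 2) := by
  have h : ∀ p : (Fin 4 × Torus.FrameIdx (Fin 3) N × Bool × Bool), ‖U p‖ ^ 2 = _ := fun p => norm_sq_of_ae_eq (hU p) (design_isConjSymm hcf hcA hcB hcC hcR p)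
  simp_rw [h]
  exact design_sum_energy_le hcf hcA hcB hcC hcR hN

include hcf hcA hcB hcC hcR hU in
/-- **Enstrophy of each atom**, as `ofReal` of the coefficient sum. [folklore] -/
theorem design_eGradNormSq (p : (Fin 4 × Torus.FrameIdx (Fin 3) N × Bool × Bool)) :
    Torus.eGradNormSq (((U p).1 : Lp (EuclideanSpace ℝ (Fin 3)) 2 (volume : Measure (UnitAddTorus (Fin 3)))) : UnitAddTorus (Fin 3) → EuclideanSpace ℝ (Fin 3)) =
      ENNReal.ofReal (4 * Real.pi ^ 2 * ∑ k ∈ ((Torus.freqBall N).erase 0), Torus.freqNormSq k * ‖(cf + cA p.1 + cB p.1 + (if p.2.2.1 then (1 : ℝ) else -1) • cC + (if p.2.2.2 then (1 : ℝ) else -1) • cR p.2.1) k‖ ^ 2) :=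
  eGradNormSq_of_ae_eq (hU p) (design_isConjSymm hcf hcA hcB hcC hcR p)

include hcf hcA hcB hcC hcR hU in
/-- **Every atom is a level-`N` field.** [folklore] -/
theorem design_level (p : (Fin 4 × Torus.FrameIdx (Fin 3) N × Bool × Bool)) :
    ∀ k ∉ (Torus.freqBall N).erase (0 : Fin 3 → ℤ),
      UnitAddTorus.mFourierCoeff (EuclideanSpace.complexify ∘ (((U p).1 : Lp (EuclideanSpace ℝ (Fin 3)) 2 (volume : Measure (UnitAddTorus (Fin 3)))) : UnitAddTorus (Fin 3) → EuclideanSpace ℝ (Fin 3))) k = 0 :=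
  level_of_ae_eq (hU p) (design_isConjSymm hcf hcA hcB hcC hcR p)

include hcR hU in
/-- **The covariance increment**: flipping the sign of the noise changes the pairing with `g` by
`2η ∫ ⟪e_a, g⟫` (`e_a` the frame field of index `a`). [folklore] -/
theorem design_pairing_flip (m : Fin 4) (a : Torus.FrameIdx (Fin 3) N) (s₁ : Bool)
    {g : UnitAddTorus (Fin 3) → EuclideanSpace ℝ (Fin 3)} (hg : Torus.IsSmooth g) :
    Torus.pairing ((U (m, a, s₁, true)).1 : Lp (EuclideanSpace ℝ (Fin 3)) 2 (volume : Measure (UnitAddTorus (Fin 3)))) g -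
      Torus.pairing ((U (m, a, s₁, false)).1 : Lp (EuclideanSpace ℝ (Fin 3)) 2 (volume : Measure (UnitAddTorus (Fin 3)))) g =
      2 * η * ∫ x, ⟪Torus.frameFieldIdx N a x, g x⟫_ℝ := by
  rw [pairing_of_ae_eq (hU _) (hg.memLp 2), pairing_of_ae_eq (hU _) (hg.memLp 2), ← Finset.sum_sub_distrib]
  have hsub : (cf + cA (m, a, s₁, true).1 + cB (m, a, s₁, true).1 + (if (m, a, s₁, true).2.2.1 then (1 : ℝ) else -1) • cC + (if (m, a, s₁, true).2.2.2 then (1 : ℝ) else -1) • cR (m, a, s₁, true).2.1) -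
      (cf + cA (m, a, s₁, false).1 + cB (m, a, s₁, false).1 + (if (m, a, s₁, false).2.2.1 then (1 : ℝ) else -1) • cC + (if (m, a, s₁, false).2.2.2 then (1 : ℝ) else -1) • cR (m, a, s₁, false).2.1) = (2 : ℝ) • cR a := by
    dsimp only
    simp only [↓reduceIte, Bool.false_eq_true, one_smul, neg_one_smul]
    module
  rw [Finset.sum_congr rfl fun k _ => by rw [← Complex.sub_re, ← inner_sub_left, ← Pi.sub_apply, hsub]]
  simp_rw [Pi.smul_apply, ← Complex.coe_smul, inner_smul_left, Complex.conj_ofReal, Complex.re_ofReal_mul]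
  rw [← Finset.mul_sum, ← Torus.integral_inner_realTrigPoly_of_integrable_left _ _ hg.integrable, hcR]
  dsimp only
  rw [realTrigPoly_polarised_frame N a η]
  simp_rw [real_inner_smul_left, integral_const_mul]
  ring


end RowSums

section Frame

/-- **A band test seen by some level-`N` field is seen by some frame field**: if `(u, g) ≠ 0` for
some `u ∈ H`, then `∫ ⟪e_a, g⟫ ≠ 0` for some Galerkin frame field `e_a` of level `N` (otherwise
the Parseval frame identity gives `‖P_N g‖ = ‖g‖ = 0`). [folklore] -/
theorem exists_frame_pairing_ne_zero (N : ℕ) {g : UnitAddTorus (Fin 3) → EuclideanSpace ℝ (Fin 3)}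
    (hg : Torus.IsSmooth g) (hdiv : Torus.IsDivFree g) (hmean : Torus.HasZeroMean g)
    (hband : ∀ k ∉ (Torus.freqBall N).erase (0 : Fin 3 → ℤ),
      UnitAddTorus.mFourierCoeff (EuclideanSpace.complexify ∘ g) k = 0)
    (hex : ∃ u : Torus.energySpace (Fin 3),
      Torus.pairing (u.1 : Lp (EuclideanSpace ℝ (Fin 3)) 2 (volume : Measure (UnitAddTorus (Fin 3)))) g ≠ 0) :
    ∃ a : Torus.FrameIdx (Fin 3) N, ∫ x, ⟪Torus.frameFieldIdx N a x, g x⟫_ℝ ≠ 0 := by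
  by_contra hall
  push Not at hall
  obtain ⟨u, hu⟩ := hex
  -- the class of `g` in `H`
  set V : Torus.energySpace (Fin 3) := ⟨(hg.memLp 2).toLp g, Torus.smoothSolenoidal_subset_energySpace
    ⟨g, hg, hdiv, hmean, MemLp.coeFn_toLp _⟩⟩ with hV
  have hVg : ((V.1 : Lp (EuclideanSpace ℝ (Fin 3)) 2 (volume : Measure (UnitAddTorus (Fin 3)))) :
      UnitAddTorus (Fin 3) → EuclideanSpace ℝ (Fin 3)) =ᵐ[volume] g := MemLp.coeFn_toLp (hg.memLp 2)
  -- its truncation is the truncation of `g`, which is `g`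
  have htrunc : Torus.fourierTruncate N (((V.1 : Lp (EuclideanSpace ℝ (Fin 3)) 2
      (volume : Measure (UnitAddTorus (Fin 3)))) : UnitAddTorus (Fin 3) → EuclideanSpace ℝ (Fin 3))) = g := by
    have hcoef : ∀ k, UnitAddTorus.mFourierCoeff (EuclideanSpace.complexify ∘ (((V.1 : Lp (EuclideanSpace ℝ (Fin 3)) 2
        (volume : Measure (UnitAddTorus (Fin 3)))) : UnitAddTorus (Fin 3) → EuclideanSpace ℝ (Fin 3)))) k =
        UnitAddTorus.mFourierCoeff (EuclideanSpace.complexify ∘ g) k := fun k => by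
      rw [Torus.mFourierCoeff_eq_integral_volume, Torus.mFourierCoeff_eq_integral_volume]
      exact integral_congr_ae (hVg.mono fun x hx => by simp only [Function.comp_apply, hx])
    rw [Torus.fourierTruncate_eq]
    simp_rw [hcoef]
    rw [← Torus.fourierTruncate_eq]
    exact Torus.fourierTruncate_eq_self hg.continuous fun k hk =>
      hband k fun h => (Torus.not_mem_freqBall.2 hk) (Finset.mem_of_mem_erase h)
  -- Parseval frame identity: `∫ ‖g‖² = Σ_a (V, e_a)² = 0`
  have hpar := Torus.sum_integral_inner_frameField_sq V.2 N
  rw [htrunc] at hpar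
  have hzero : ∀ (k : ↥(Torus.freqBall₀ (d := Fin 3) N)) (j : Fin 3) (c : Bool),
      (∫ y, ⟪(((V.1 : Lp (EuclideanSpace ℝ (Fin 3)) 2 (volume : Measure (UnitAddTorus (Fin 3)))) :
        UnitAddTorus (Fin 3) → EuclideanSpace ℝ (Fin 3)) y), Torus.frameField (k : Fin 3 → ℤ) j c y⟫_ℝ) = 0 := by
    intro k j c
    have h := hall (k, j, c)
    rw [← h]
    refine integral_congr_ae (hVg.mono fun x hx => ?_)
    simp only [hx]
    exact real_inner_comm _ _
  have hsum : ∑ k ∈ Torus.freqBall₀ N, ∑ j : Fin 3, ∑ c : Bool,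
      (∫ y, ⟪(((V.1 : Lp (EuclideanSpace ℝ (Fin 3)) 2 (volume : Measure (UnitAddTorus (Fin 3)))) :
        UnitAddTorus (Fin 3) → EuclideanSpace ℝ (Fin 3)) y), Torus.frameField k j c y⟫_ℝ) ^ 2 = 0 := by
    rw [← Finset.sum_coe_sort]
    exact Finset.sum_eq_zero fun k _ => Finset.sum_eq_zero fun j _ => Finset.sum_eq_zero fun c _ => by
      rw [hzero k j c, zero_pow two_ne_zero]
  rw [hsum] at hpar
  -- hence `g = 0` a.e., contradicting `(u, g) ≠ 0`
  have hg0 : (fun x => ‖g x‖ ^ 2) =ᵐ[volume] 0 :=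
    (integral_eq_zero_iff_of_nonneg (fun x => sq_nonneg _) ((hg.memLp 2).integrable_norm_pow two_ne_zero)).1
      hpar.symm
  have hg0' : g =ᵐ[volume] 0 := hg0.mono fun x hx => by
    have : ‖g x‖ ^ 2 = 0 := hx
    exact norm_eq_zero.1 (pow_eq_zero_iff two_ne_zero |>.1 this)
  refine hu ?_
  unfold Torus.pairing
  rw [integral_congr_ae (hg0'.mono fun x hx => by simp only [hx] : (fun x => ⟪((u.1 : Lp (EuclideanSpace ℝ (Fin 3)) 2
      (volume : Measure (UnitAddTorus (Fin 3)))) : UnitAddTorus (Fin 3) → EuclideanSpace ℝ (Fin 3)) x, g x⟫_ℝ) =ᵐ[volume]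
      fun x => ⟪((u.1 : Lp (EuclideanSpace ℝ (Fin 3)) 2 (volume : Measure (UnitAddTorus (Fin 3)))) :
        UnitAddTorus (Fin 3) → EuclideanSpace ℝ (Fin 3)) x, (0 : UnitAddTorus (Fin 3) → EuclideanSpace ℝ (Fin 3)) x⟫_ℝ)]
  simp

end Frame

/-- **Registered sub-goal `designRowSums_exists_frame_pairing_ne_zero` of stub S6** (summary of
this file's covariance device): a band test seen by some field of the energy space is seen by some
Galerkin frame field. [folklore] -/
theorem designRowSums_exists_frame_pairing_ne_zero : ∀ (N : ℕ) (g : UnitAddTorus (Fin 3) → EuclideanSpace ℝ (Fin 3)), Torus.IsSmooth g → Torus.IsDivFree g → Torus.HasZeroMean g → (∀ k ∉ (Torus.freqBall N).erase (0 : Fin 3 → ℤ), UnitAddTorus.mFourierCoeff (EuclideanSpace.complexify ∘ g) k = 0) → (∃ u : Torus.energySpace (Fin 3), Torus.pairing u.1 g ≠ 0) → ∃ a : Torus.FrameIdx (Fin 3) N, ∫ x, ⟪Torus.frameFieldIdx N a x, g x⟫_ℝ ≠ 0 :=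
  fun N _ hg hdiv hmean hband hex => exists_frame_pairing_ne_zero N hg hdiv hmean hband hex

end Summit.AnomalousDissipation.AnomalousDissipation.Theorems.MomentParityQuarticGate
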